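import Summits.AtomisticToContinuum.BoseEinsteinCondensation.Theorems.BECSwapNoCatastropheTorusHalfSwapOverlapAbsHardLayerPBasics
import Literature.MathematicalPhysics.QuantumManyBody.BoseGasHardCrossingLines
import HarnessLib

/-!
# Finite-energy functions vanish a.e. on the pair-profile hard configurations (stub X of the `H` chain)

Route `BECSwapNoCatastrophe`, crux `TorusHalfSwapOverlap` (stmt-AtomisticToContinuum-14393), line `registered`
(skeleton v8, truncation split), stub X `stub_hardLayerPVanishing` of the hard-core maximal-form bound H on the
ABSOLUTE (symmetry-free) class for PAIR-DEPENDENT profiles `V i j`. This file is the pair-profile twin of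
`Literature/MathematicalPhysics/QuantumManyBody/BoseGasHardCrossingLines.lean` under the dictionary
`hardRad v ↦ hardRad (V i j)` (per pair), `hardLayer v L s ↦ hardLayerP V L s`,
`periodicInteraction v L ↦ pairInteraction V L`, `Measurable v ↦ ∀ i j, Measurable (V i j)` plus the symmetry
`V i j = V j i` of the profile matrix; Bose symmetry of states plays no role:

* `crossingP_lineRepr_eq_zero_of_crossing` — on a good line of particle `i` in direction `k` (the representative
  `G` is the integral of `H` along it and the line potential energy `∫ W_V |G|²` is locally finite), `G` vanishes
  at every TRANSVERSAL crossing of a hard sphere of the profile `V i j` by an image pair `(i, j, n)`;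
* `stub_hardLayerPVanishing` — **a finite-energy function vanishes a.e. on `fromUnitTorusN L ⁻¹' hardLayerP V L 0`**
  (the configurations with an image pair of a pair WITH hard radii exactly on one of its hard spheres).

The `v`-independent facts (coincidences `xᵢ - xⱼ = Ln` are Haar-null, line geometry) are imported from the
one-copy files (`HardLayerAux.volume_pairRad_eq_zero`, `BoseGasLineGeometry`).

## References

* E. H. Lieb, R. Seiringer, J. P. Solovej, J. Yngvason, *The Mathematics of the Bose Gas and its Condensation*,
  Oberwolfach Seminars 34, Birkhäuser 2005, Ch. 2, paragraph after eq. (2.1). [LSSY2005]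
-/

noncomputable section

namespace Summit.AtomisticToContinuum.BoseEinsteinCondensation.Cruxes.TorusHalfSwapOverlap.TruncationSplit

open MeasureTheory Filter Topology Set Metric
open scoped ENNReal NNReal InnerProductSpace ComplexConjugate
open Literature.MathematicalPhysics.QuantumManyBody.BoseGas
open Literature.Analysis.FunctionSpaces
open Summit.AtomisticToContinuum.BoseEinsteinCondensation.AbsTorus

-- The measure on `ℝ/ℤ` is the Haar PROBABILITY measure, as in `PeriodicFormDomain.lean`.
attribute [local instance] formDomain_measureSpace formDomain_isProbabilityMeasure formDomain_isProbabilityMeasure_pi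

variable {N : ℕ} {L : ℝ} {V : Fin N → Fin N → ℝ → ℝ≥0∞}

/-! ### Vanishing at transversal hard crossings along good lines (pair-profile version) -/

/-- **Vanishing at a transversal hard crossing on a good line (pair-profile interaction).** Let the profile
matrix `V` be symmetric with `V i j` measurable, and let particle `i` move in direction `k` through the torus
point `t` along a good line (`G` is the integral of the locally integrable `H` along it, and the line potential
energy `∫ W_V |G|²` is locally finite). If at the parameter `x₀` the image pair `(i, j, n)` sits exactly on a hard
sphere of ITS profile, `|y + L x₀ e_k| ∈ hardRad (V i j)` (`y = xᵢ - xⱼ - Ln`), transversally (`y_k + L x₀ ≠ 0`),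
then `G(t + x₀ 𝐞_{(i,k)}) = 0`. [cite: LSSY2005, Ch. 2, paragraph after eq. (2.1)] -/
theorem crossingP_lineRepr_eq_zero_of_crossing (hL : 0 < L) (hVs : ∀ i j, V i j = V j i) {i j : Fin N}
    (hij : i ≠ j) (hVij : Measurable (V i j)) (k : Fin 3)
    {G H : UnitAddTorus (Fin N × Fin 3) → ℂ} {t : UnitAddTorus (Fin N × Fin 3)}
    (hACL : ∀ a b : ℝ, IntervalIntegrable (fun x : ℝ => H (t + Pi.single (i, k) ((x : ℝ) : UnitAddCircle))) volume a b ∧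
      G (t + Pi.single (i, k) ((b : ℝ) : UnitAddCircle)) - G (t + Pi.single (i, k) ((a : ℝ) : UnitAddCircle)) =
        ∫ x in a..b, H (t + Pi.single (i, k) ((x : ℝ) : UnitAddCircle)))
    (hfin : ∀ a b : ℝ, ∫⁻ x in Ioo a b, pairInteraction V L
        (fromUnitTorusN L (t + Pi.single (i, k) ((x : ℝ) : UnitAddCircle))) *
          ‖G (t + Pi.single (i, k) ((x : ℝ) : UnitAddCircle))‖ₑ ^ 2 ≠ ⊤)
    (n : Fin 3 → ℤ) {x₀ : ℝ}
    (hhard : ‖(fromUnitTorusN L t i - fromUnitTorusN L t j - latticeVec L n) +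
        (L * x₀) • EuclideanSpace.single k (1 : ℝ)‖ ∈ hardRad (V i j))
    (htrans : (fromUnitTorusN L t i - fromUnitTorusN L t j - latticeVec L n) k + L * x₀ ≠ 0) :
    G (t + Pi.single (i, k) ((x₀ : ℝ) : UnitAddCircle)) = 0 := by
  -- adapted from `lineRepr_eq_zero_of_crossing` (Literature/…/BoseGasHardCrossingLines.lean)
  set X : Config N := fromUnitTorusN L t with hX
  set y : Space := X i - X j - latticeVec L n with hy
  set ρ : ℝ → ℝ := fun x => ‖y + (L * x) • EuclideanSpace.single k (1 : ℝ)‖ with hρ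
  set c : ℝ := y k + L * x₀ with hc
  have hc0 : 0 < |c| := abs_pos.2 htrans
  set δ : ℝ := |c| / (2 * L) with hδ
  have hδ0 : 0 < δ := by positivity
  have hLδ : L * δ = |c| / 2 := by rw [hδ]; field_simp
  -- sign control on `[x₀ - δ, x₀ + δ]`
  have hsign : ∀ x ∈ Icc (x₀ - δ) (x₀ + δ), |(y k + L * x) - c| ≤ |c| / 2 := by
    intro x hx
    rw [show y k + L * x - c = L * (x - x₀) by rw [hc]; ring, abs_mul, abs_of_pos hL, ← hLδ]
    exact mul_le_mul_of_nonneg_left (abs_le.2 ⟨by linarith [hx.1], by linarith [hx.2]⟩) hL.le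
  have hne : ∀ x ∈ Icc (x₀ - δ) (x₀ + δ), ρ x ≠ 0 := by
    intro x hx h0
    have h1 : 0 < |y k + L * x| := by
      have := hsign x hx
      have h2 : |c| - |y k + L * x - c| ≤ |y k + L * x| := by
        have := abs_sub_abs_le_abs_sub c (c - (y k + L * x))
        rw [sub_sub_cancel, abs_sub_comm c] at this
        linarith
      linarith
    have h2 := abs_add_le_norm_add_smul_single y k (L * x)
    rw [show ‖y + (L * x) • EuclideanSpace.single k (1 : ℝ)‖ = ρ x from rfl, h0] at h2
    linarith
  -- the line potential dominates `(V i j) ∘ ρ` (symmetry of the profile matrix for the orientation of the pair)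
  have hpot : ∀ x : ℝ, V i j (ρ x) ≤ pairInteraction V L
      (fromUnitTorusN L (t + Pi.single (i, k) ((x : ℝ) : UnitAddCircle))) := by
    intro x
    have h1 : ρ x = pairRad L (X + (L * x) • (Pi.single i (EuclideanSpace.single k (1 : ℝ)) : Config N)) i j n := by
      rw [pairRad_add_smul_single_left L X hij k n (L * x)]
    rw [h1, ← toUnitTorusN_smul_single hL.ne' i k x,
      (isTorusPeriodic_pairInteraction V L).apply_fromUnitTorusN_add hL t]
    exact apply_pairRad_le_pairInteraction hVs L _ hij n
  refine eq_zero_of_hardRad_of_lineEnergy_ne_top (f := fun x => G (t + Pi.single (i, k) ((x : ℝ) : UnitAddCircle)))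
    (ρ := ρ) (ρ' := fun x => (y k + L * x) / ρ x * L) (K := L) hVij (a := x₀ - δ) (b := x₀ + δ) (τ₀ := x₀)
    (by linarith) (by linarith) (by rw [hρ]; fun_prop) ?_ ?_ ?_ hhard ?_ ?_
  · -- strict monotonicity
    rcases lt_or_gt_of_ne htrans with hneg | hpos
    · right
      intro a ha b hb hab
      have ha' : y k + L * a ≤ 0 := by
        have := hsign a ha; rw [abs_of_neg hneg] at this; linarith [(abs_le.1 this).2]
      have hb' : y k + L * b ≤ 0 := by
        have := hsign b hb; rw [abs_of_neg hneg] at this; linarith [(abs_le.1 this).2]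
      exact strictAntiOn_norm_add_smul_single y k (show L * a ∈ Iic (-(y k)) by rw [mem_Iic]; linarith)
        (show L * b ∈ Iic (-(y k)) by rw [mem_Iic]; linarith) (mul_lt_mul_of_pos_left hab hL)
    · left
      intro a ha b hb hab
      have ha' : 0 ≤ y k + L * a := by
        have := hsign a ha; rw [abs_of_pos hpos] at this; linarith [(abs_le.1 this).1]
      have hb' : 0 ≤ y k + L * b := by
        have := hsign b hb; rw [abs_of_pos hpos] at this; linarith [(abs_le.1 this).1]
      exact strictMonoOn_norm_add_smul_single y k (show L * a ∈ Ici (-(y k)) by rw [mem_Ici]; linarith)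
        (show L * b ∈ Ici (-(y k)) by rw [mem_Ici]; linarith) (mul_lt_mul_of_pos_left hab hL)
  · -- derivative
    intro x hx
    have h1 := hasDerivAt_norm_add_smul_single y k (τ := L * x) (hne x (Ioo_subset_Icc_self hx))
    have h2 : HasDerivAt (fun x : ℝ => L * x) L x := by simpa using (hasDerivAt_id x).const_mul L
    exact (h1.comp x h2).hasDerivWithinAt
  · -- `|ρ'| ≤ L`
    intro x _
    rw [abs_mul, abs_of_pos hL]
    exact mul_le_of_le_one_left hL.le (abs_deriv_norm_add_smul_single_le_one y k (L * x))
  · exact (continuous_line_of_ACL (G := G) (H := H) (t := t)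
      (fun x : ℝ => (Pi.single (i, k) ((x : ℝ) : UnitAddCircle) : UnitAddTorus (Fin N × Fin 3))) hACL).continuousAt
  · refine ne_top_of_le_ne_top (hfin (x₀ - δ) (x₀ + δ)) (lintegral_mono fun x => ?_)
    gcongr
    exact hpot x

/-! ### Vanishing a.e. on the pair-profile hard configurations -/

open HardLayerAux in
/-- **Stub X: a finite-energy function vanishes a.e. on the pair-profile hard configurations** (twin of
`ae_eq_zero_of_mem_hardLayer_zero`). Let `L > 0`, `V` a symmetric matrix of measurable profiles, and `η` a function
on `(ℝ/ℤ)^{3N}` such that for every coordinate `q = (i, k)` there are `G_q = η` a.e. and `H_q` with, for a.e. `t`,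
the ACL property of `G_q` along the `q`-line through `t` (with derivative `H_q`) and locally finite line potential
energy `∫ W_V(fromUnitTorusN L ·)|G_q|²` along it. Then `η = 0` a.e. on `fromUnitTorusN L ⁻¹' hardLayerP V L 0` (the
configurations with an image pair `(i, j, n)` of a pair whose profile HAS hard radii exactly on a hard sphere of
`V i j`): on the good lines the representatives vanish at the transversal crossings at parameter `0`
(`crossingP_lineRepr_eq_zero_of_crossing`), coincidences `xᵢ - xⱼ = Ln` are Haar-null
(`HardLayerAux.volume_pairRad_eq_zero`), and off the coincidences every image pair on a hard sphere is crossed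
transversally by one of the three coordinate lines of particle `i` (`exists_norm_sq_le_three_mul_sq`).
[cite: LSSY2005, Ch. 2, paragraph after eq. (2.1)] -/
theorem stub_hardLayerPVanishing :
    ∀ (N : ℕ) (L : ℝ), 0 < L → ∀ V : Fin N → Fin N → ℝ → ℝ≥0∞, (∀ i j, V i j = V j i) →
      (∀ i j, Measurable (V i j)) →
      ∀ (η : UnitAddTorus (Fin N × Fin 3) → ℂ) (G H : Fin N × Fin 3 → UnitAddTorus (Fin N × Fin 3) → ℂ),
        (∀ q, G q =ᵐ[volume] η) →
        (∀ q : Fin N × Fin 3, ∀ᵐ t ∂(volume : Measure (UnitAddTorus (Fin N × Fin 3))),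
        (∀ a b : ℝ, IntervalIntegrable (fun x : ℝ => H q (t + Pi.single q ((x : ℝ) : UnitAddCircle))) volume a b ∧
          G q (t + Pi.single q ((b : ℝ) : UnitAddCircle)) - G q (t + Pi.single q ((a : ℝ) : UnitAddCircle)) =
            ∫ x in a..b, H q (t + Pi.single q ((x : ℝ) : UnitAddCircle))) ∧
        (∀ a b : ℝ, ∫⁻ x in Set.Ioo a b, pairInteraction V L
          (fromUnitTorusN L (t + Pi.single q ((x : ℝ) : UnitAddCircle))) *
            ‖G q (t + Pi.single q ((x : ℝ) : UnitAddCircle))‖ₑ ^ 2 ≠ ⊤)) →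
        ∀ᵐ t ∂(volume : Measure (UnitAddTorus (Fin N × Fin 3))), fromUnitTorusN L t ∈ hardLayerP V L 0 → η t = 0 := by
  -- adapted from `ae_eq_zero_of_mem_hardLayer_zero` (Literature/…/BoseGasHardCrossingLines.lean)
  intro N L hL V hVs hVm η G H hGη hgood
  -- on the lines: transversal crossings at parameter `0`
  have key : ∀ (i j : Fin N) (n : Fin 3 → ℤ) (k : Fin 3), i ≠ j →
      ∀ᵐ t ∂(volume : Measure (UnitAddTorus (Fin N × Fin 3))),
        (pairRad L (fromUnitTorusN L t) i j n ∈ hardRad (V i j) ∧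
          (fromUnitTorusN L t i - fromUnitTorusN L t j - latticeVec L n) k ≠ 0) → η t = 0 := by
    intro i j n k hij
    filter_upwards [hgood (i, k), hGη (i, k)] with t ht hG
    rintro ⟨hmem, hk⟩
    rw [← hG]
    have h := crossingP_lineRepr_eq_zero_of_crossing hL hVs hij (hVm i j) k ht.1 ht.2 n (x₀ := 0)
      (by rw [mul_zero, zero_smul, add_zero]; exact hmem) (by rwa [mul_zero, add_zero])
    simpa using h
  -- coincidences are null
  have hnull : ∀ (i j : Fin N) (n : Fin 3 → ℤ), i ≠ j →
      ∀ᵐ t ∂(volume : Measure (UnitAddTorus (Fin N × Fin 3))), pairRad L (fromUnitTorusN L t) i j n ≠ 0 := by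
    intro i j n hij
    exact measure_eq_zero_iff_ae_notMem.1 (volume_pairRad_eq_zero (N := N) hL hij n)
  -- gather the countably many statements
  have hkey' : ∀ᵐ t ∂(volume : Measure (UnitAddTorus (Fin N × Fin 3))), ∀ (i j : Fin N) (n : Fin 3 → ℤ) (k : Fin 3),
      i ≠ j → (pairRad L (fromUnitTorusN L t) i j n ∈ hardRad (V i j) ∧
        (fromUnitTorusN L t i - fromUnitTorusN L t j - latticeVec L n) k ≠ 0) → η t = 0 := by
    refine ae_all_iff.2 fun i => ae_all_iff.2 fun j => ae_all_iff.2 fun n => ae_all_iff.2 fun k => ?_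
    by_cases hij : i = j
    · exact Eventually.of_forall fun t h => absurd hij h
    · filter_upwards [key i j n k hij] with t ht _ using ht
  have hnull' : ∀ᵐ t ∂(volume : Measure (UnitAddTorus (Fin N × Fin 3))), ∀ (i j : Fin N) (n : Fin 3 → ℤ),
      i ≠ j → pairRad L (fromUnitTorusN L t) i j n ≠ 0 := by
    refine ae_all_iff.2 fun i => ae_all_iff.2 fun j => ae_all_iff.2 fun n => ?_
    by_cases hij : i = j
    · exact Eventually.of_forall fun t h => absurd hij h
    · filter_upwards [hnull i j n hij] with t ht _ using ht
  filter_upwards [hkey', hnull'] with t hK hn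
  rintro ⟨i, j, n, hij, hne, hle⟩
  have hmem : pairRad L (fromUnitTorusN L t) i j n ∈ hardRad (V i j) :=
    (isClosed_hardRad.mem_iff_infDist_zero hne).2 (le_antisymm hle infDist_nonneg)
  set y : Space := fromUnitTorusN L t i - fromUnitTorusN L t j - latticeVec L n with hy
  obtain ⟨k, hk⟩ := exists_norm_sq_le_three_mul_sq y
  have hy0 : ‖y‖ ≠ 0 := hn i j n hij
  have hyk : y k ≠ 0 := by
    intro h
    rw [h] at hk
    have : ‖y‖ ^ 2 ≤ 0 := by simpa using hk
    exact hy0 (by nlinarith [norm_nonneg y])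
  exact hK i j n k hij ⟨hmem, hyk⟩

end Summit.AtomisticToContinuum.BoseEinsteinCondensation.Cruxes.TorusHalfSwapOverlap.TruncationSplit

end
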